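/-
Copyright (c) 2026 the pub-hodgecm-mathlib formalisation cell (harness21).  Prover seat hodgecm-mathlib-A-p06 (g29) — (U) road, U4-DISCHARGE brick (b3)-(ii) «null complement + exhaustion», FILE 2 «exhaustion ⇒ total mass»
(LEAD F0P3a-plan (g10) WORDS T9-40 (d1) ∕ T9-41 (3); owner A-p19 (g24); split with A-p12 (g20) (b3)-(i)(iii) and F0P3-p03 (g11) (d2) 13:31Z).
-/
import Literature.NumberTheory.Weil1964.UnitaryArchLocalCayleySingularNull   -- FILE 1 (A-p06 g29): `measure_univ_eq_measure_image_cayleySourceC`, `setLIntegral_cayleySourceC_eq`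
import HarnessLib

/-!
# The Cayley chart source exhausts: `μ(U(Jw)(ℂ)) = ∫_{𝔲(Jw)} w₀ dλ` from the any-window identity
# ((U) road, U4-DISCHARGE brick (b3)-(ii), FILE 2 of 2; Helgason 2000 Ch. I §1 Thm. 1.14; Weyl 1939 Ch. II §10)

Topic `NumberTheory/Weil1964` (the D-T ∕ (U) road's measure bricks), namespace `Literature.NumberTheory.Weil1964.UnitaryArchLocalTopForm` (that of ★ U1 FILES A∕B∕C).
THEOREMS ONLY: no definition, no named fact (net debt 0), no instance, no notation, no `sorry`.  Cell `pub/hodgecm-mathlib`, crux H413 = `stmt-HodgeConjecture-24833`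
(supports only).  GENERIC over the one-place form `Jw ∈ M_N(ℂ)` — no CM field, no slicing; the CM any-window identity that feeds `hwin` below is the companion file
`UnitaryArchLocalTopFormHaarWindowAny` (slice of ★ (P0) `archTopFormHaar_restrict_image_of_isOpen` through ★ U2 `map_archPiEquivCM_archTopFormHaar`).
HONEST LABEL: HC_CM is proved only modulo the 2 remaining named inputs (hLiu418 24832, h413 24833) until rung 0 closes; this file discharges no printed statement —
it is measure-theoretic bookkeeping for the in-house discharge of U4 `ArchTopFormWallCompatible` (the VALUE `vol^TF(U(2))·vol^TF(U(1))`, A-p12 (g20) (b3)-(iii)).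

THE ARGUMENT.  The explicit admissible exhaustion `V n = {‖X‖ < n+2, (n+2)⁻¹ < |det(1 ± X)|}` of the chart source (open, `∋ 0`, inside the compact
`K n = {‖X‖ ≤ n+2, (n+2)⁻¹ ≤ |det(1 ± X)|} ⊆ source`, increasing, `⋃ V n = source`; `exhaustion_spec`) turns an ANY-WINDOW identity `μ(ĉ(V)) = ∫_V w₀ dλ` (hypothesis `hwin`,
for all admissible `V`) into `μ(ĉ(source)) = ∫_{source} w₀ dλ` (`Monotone.measure_iUnion` on both sides, the right one read as the measure `w₀ · λ`), and with FILE 1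
(`μ(univ) = μ(ĉ(source))`, `λ(sourceᶜ) = 0`) into **`μ(univ) = ∫_{𝔲(Jw)} w₀ dλ`** (`measure_univ_eq_lintegral_cayleyWeightC_of_window`).  The restriction-form any-window
identity (★ (P0)'s shape) implies the total-mass form (`measure_image_eq_lintegral_of_restrict_eq`).

## References
* S. Helgason, *Groups and Geometric Analysis*, AMS Math. Surveys Monogr. 83 (2000), Ch. I §1 Thm. 1.14 p. 96. [Helgason2000]
* H. Weyl, *The Classical Groups, their Invariants and Representations*, Princeton (1939), Ch. II §10. [Weyl1939]
* A. W. Knapp, *Lie Groups Beyond an Introduction*, 2nd ed., Birkhäuser (2002), VIII §2. [Knapp2002]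
-/

set_option autoImplicit false
-- the scoped normed structure on the submodule `𝔲(Jw) ≤ M_N(ℂ)` is only reducibly defeq to the subtype uniformity ∕ topology carried by the
-- `[BorelSpace ↥(skewC …)]` binder (as in ★ U1 FILES A∕B)
set_option backward.isDefEq.respectTransparency false

noncomputable section

open Set Filter Topology MeasureTheory MeasureTheory.Measure Literature.Analysis.Calculus Polynomial
open scoped Classical Matrix Matrix.Norms.Operator MatrixGroups ENNReal NNReal Pointwise

namespace Literature.NumberTheory.Weil1964

namespace UnitaryArchLocalTopForm

open Literature.NumberTheory.Automorphic Literature.NumberTheory.Automorphic.UnitaryGroup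

/-! ## Exhaustion of the chart source by admissible windows, and the total mass -/

section Exhaustion

variable {N : ℕ} {Jw : Matrix (Fin N) (Fin N) ℂ}

/-- `(n + 2)⁻¹`-thresholds: `0 < n + 2` as a real number. [cite: Helgason2000, Ch. I §1 Thm. 1.14 p. 96] -/
theorem two_add_pos (n : ℕ) : (0 : ℝ) < n + 2 := by positivity

variable (N Jw) in
/-- THE ADMISSIBLE EXHAUSTION (inside proofs only; stated as a `Set`-valued function for readability of the lemmas below): `V n = {‖X‖ < n+2, (n+2)⁻¹ < |det(1 ± X)|}`.
This is a THEOREM-level abbreviation realised by `Set.sep`; no `def` is introduced — see `exhaustion_spec`. [cite: Helgason2000, Ch. I §1 Thm. 1.14 p. 96] -/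
theorem exhaustion_spec :
    ∃ V K : ℕ → Set (skewC N Jw),
      (∀ n, IsOpen (V n)) ∧ (∀ n, (0 : skewC N Jw) ∈ V n) ∧ (∀ n, IsCompact (K n)) ∧ (∀ n, K n ⊆ cayleySourceC N Jw) ∧ (∀ n, V n ⊆ K n) ∧
      Monotone V ∧ (⋃ n, V n) = cayleySourceC N Jw := by
  haveI : FiniteDimensional ℝ (Matrix (Fin N) (Fin N) ℂ) := finiteDimensional_matrixC
  let dp : skewC N Jw → ℝ := fun X => ‖(1 + (X : Matrix (Fin N) (Fin N) ℂ)).det‖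
  let dm : skewC N Jw → ℝ := fun X => ‖(1 - (X : Matrix (Fin N) (Fin N) ℂ)).det‖
  have hdp : Continuous dp := (Continuous.matrix_det (continuous_const.add continuous_subtype_val)).norm
  have hdm : Continuous dm := (Continuous.matrix_det (continuous_const.sub continuous_subtype_val)).norm
  let V : ℕ → Set (skewC N Jw) := fun n => Metric.ball 0 (n + 2) ∩ {X | ((n : ℝ) + 2)⁻¹ < dp X} ∩ {X | ((n : ℝ) + 2)⁻¹ < dm X}
  let K : ℕ → Set (skewC N Jw) := fun n => Metric.closedBall 0 (n + 2) ∩ {X | ((n : ℝ) + 2)⁻¹ ≤ dp X} ∩ {X | ((n : ℝ) + 2)⁻¹ ≤ dm X}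
  have hsource : ∀ X : skewC N Jw, 0 < dp X → 0 < dm X → X ∈ cayleySourceC N Jw := by
    intro X hp hm
    rw [mem_cayleySourceC_iff, Matrix.isUnit_iff_isUnit_det, Matrix.isUnit_iff_isUnit_det, isUnit_iff_ne_zero, isUnit_iff_ne_zero]
    exact ⟨fun h => by simp [dp, h] at hp, fun h => by simp [dm, h] at hm⟩
  refine ⟨V, K, fun n => ?_, fun n => ?_, fun n => ?_, fun n => ?_, fun n => ?_, ?_, ?_⟩
  · exact (Metric.isOpen_ball.inter (isOpen_lt continuous_const hdp)).inter (isOpen_lt continuous_const hdm)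
  · have h1 : ((n : ℝ) + 2)⁻¹ < 1 := inv_lt_one_of_one_lt₀ (by linarith)
    refine ⟨⟨Metric.mem_ball_self (two_add_pos n), ?_⟩, ?_⟩
    · change ((n : ℝ) + 2)⁻¹ < ‖(1 + ((0 : skewC N Jw) : Matrix (Fin N) (Fin N) ℂ)).det‖
      rwa [Submodule.coe_zero, add_zero, Matrix.det_one, norm_one]
    · change ((n : ℝ) + 2)⁻¹ < ‖(1 - ((0 : skewC N Jw) : Matrix (Fin N) (Fin N) ℂ)).det‖
      rwa [Submodule.coe_zero, sub_zero, Matrix.det_one, norm_one]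
  · exact ((isCompact_closedBall (0 : skewC N Jw) _).inter_right (isClosed_le continuous_const hdp)).inter_right (isClosed_le continuous_const hdm)
  · intro X hX
    exact hsource X ((inv_pos.2 (two_add_pos n)).trans_le hX.1.2) ((inv_pos.2 (two_add_pos n)).trans_le hX.2)
  · rintro X ⟨⟨h1, h2⟩, h3⟩
    refine ⟨⟨Metric.ball_subset_closedBall h1, ?_⟩, ?_⟩
    · change ((n : ℝ) + 2)⁻¹ ≤ dp X
      exact le_of_lt h2
    · change ((n : ℝ) + 2)⁻¹ ≤ dm X
      exact le_of_lt h3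
  · intro n m hnm X hX
    have hnm' : (n : ℝ) + 2 ≤ (m : ℝ) + 2 := by simpa using (Nat.cast_le.2 hnm : (n : ℝ) ≤ m)
    have hinv : ((m : ℝ) + 2)⁻¹ ≤ ((n : ℝ) + 2)⁻¹ := inv_anti₀ (two_add_pos n) hnm'
    exact ⟨⟨Metric.ball_subset_ball hnm' hX.1.1, hinv.trans_lt hX.1.2⟩, hinv.trans_lt hX.2⟩
  · apply Set.Subset.antisymm
    · exact Set.iUnion_subset fun n X hX => hsource X ((inv_pos.2 (two_add_pos n)).trans hX.1.2) ((inv_pos.2 (two_add_pos n)).trans hX.2)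
    · intro X hX
      rw [mem_cayleySourceC_iff, Matrix.isUnit_iff_isUnit_det, Matrix.isUnit_iff_isUnit_det, isUnit_iff_ne_zero, isUnit_iff_ne_zero] at hX
      have hp : 0 < dp X := norm_pos_iff.2 hX.1
      have hm : 0 < dm X := norm_pos_iff.2 hX.2
      obtain ⟨n, hn⟩ := exists_nat_gt (max ‖X‖ (max (dp X)⁻¹ (dm X)⁻¹))
      have hn2 : max ‖X‖ (max (dp X)⁻¹ (dm X)⁻¹) < (n : ℝ) + 2 := hn.trans (by linarith)
      rw [Set.mem_iUnion]
      refine ⟨n, ⟨⟨?_, ?_⟩, ?_⟩⟩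
      · rw [Metric.mem_ball, dist_zero_right]; exact (le_max_left _ _).trans_lt hn2
      · change ((n : ℝ) + 2)⁻¹ < dp X
        rw [inv_lt_comm₀ (two_add_pos n) hp]
        exact ((le_max_left _ _).trans (le_max_right _ _)).trans_lt hn2
      · change ((n : ℝ) + 2)⁻¹ < dm X
        rw [inv_lt_comm₀ (two_add_pos n) hm]
        exact ((le_max_right _ _).trans (le_max_right _ _)).trans_lt hn2

variable [MeasurableSpace (skewC N Jw)] [BorelSpace (skewC N Jw)] [MeasurableSpace (GL (Fin N) ℂ)] [BorelSpace (GL (Fin N) ℂ)]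

omit [BorelSpace (GL (Fin N) ℂ)] in
/-- **EXHAUSTION**: an ANY-WINDOW identity `μ(ĉ '' V) = ∫_V w₀ dλ` for all admissible `V` (open, `∋ 0`, inside a compact `K ⊆ source`) gives
`μ(ĉ '' source) = ∫_{source} w₀ dλ` (monotone union along the admissible exhaustion on both sides). [cite: Helgason2000, Ch. I §1 Thm. 1.14 p. 96] -/
theorem measure_image_cayleySourceC_eq_lintegral_of_window (μ : Measure (unitaryGroupOfForm (starRingEnd ℂ) Jw)) (lam : Measure (skewC N Jw))
    (hwin : ∀ V K : Set (skewC N Jw), IsOpen V → (0 : skewC N Jw) ∈ V → IsCompact K → K ⊆ cayleySourceC N Jw → V ⊆ K →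
      μ (cayleyChartC N Jw '' V) = ∫⁻ X in V, ENNReal.ofReal (cayleyWeightC N Jw X) ∂lam) :
    μ (cayleyChartC N Jw '' cayleySourceC N Jw) = ∫⁻ X in cayleySourceC N Jw, ENNReal.ofReal (cayleyWeightC N Jw X) ∂lam := by
  obtain ⟨V, K, hVo, hV0, hKc, hKs, hVK, hmono, hU⟩ := exhaustion_spec N Jw
  have himono : Monotone fun n => cayleyChartC N Jw '' V n := fun n m hnm => Set.image_mono (hmono hnm)
  rw [← hU, Set.image_iUnion, himono.measure_iUnion]
  -- the right-hand side as the `w₀ · λ`-measure of the union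
  have hrhs : ∀ S : Set (skewC N Jw), MeasurableSet S →
      ∫⁻ X in S, ENNReal.ofReal (cayleyWeightC N Jw X) ∂lam = (lam.withDensity fun X => ENNReal.ofReal (cayleyWeightC N Jw X)) S :=
    fun S hS => (withDensity_apply _ hS).symm
  rw [hrhs _ (MeasurableSet.iUnion fun n => (hVo n).measurableSet), hmono.measure_iUnion]
  exact iSup_congr fun n => by rw [hwin (V n) (K n) (hVo n) (hV0 n) (hKc n) (hKs n) (hVK n), hrhs _ (hVo n).measurableSet]

/-- **THE TOTAL MASS FROM THE ANY-WINDOW IDENTITY**: for a left-invariant `μ` finite on compacta on `U(Jw)(ℂ)`, a translation-invariant `lam` finite on compacta on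
`𝔲(Jw)`, and the any-window identity between them, `μ(U(Jw)(ℂ)) = ∫_{𝔲(Jw)} w₀ dλ`. [cite: Helgason2000, Ch. I §1 Thm. 1.14 p. 96] [cite: Weyl1939, Ch. II §10] -/
theorem measure_univ_eq_lintegral_cayleyWeightC_of_window (μ : Measure (unitaryGroupOfForm (starRingEnd ℂ) Jw)) [IsFiniteMeasureOnCompacts μ] [μ.IsMulLeftInvariant]
    (lam : Measure (skewC N Jw)) [IsFiniteMeasureOnCompacts lam] [lam.IsAddLeftInvariant]
    (hwin : ∀ V K : Set (skewC N Jw), IsOpen V → (0 : skewC N Jw) ∈ V → IsCompact K → K ⊆ cayleySourceC N Jw → V ⊆ K →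
      μ (cayleyChartC N Jw '' V) = ∫⁻ X in V, ENNReal.ofReal (cayleyWeightC N Jw X) ∂lam) :
    μ Set.univ = ∫⁻ X, ENNReal.ofReal (cayleyWeightC N Jw X) ∂lam := by
  rw [measure_univ_eq_measure_image_cayleySourceC μ, measure_image_cayleySourceC_eq_lintegral_of_window μ lam hwin, setLIntegral_cayleySourceC_eq lam]

/-- The same with the integral over the chart source. [cite: Helgason2000, Ch. I §1 Thm. 1.14 p. 96] -/
theorem measure_univ_eq_setLIntegral_cayleyWeightC_of_window (μ : Measure (unitaryGroupOfForm (starRingEnd ℂ) Jw)) [IsFiniteMeasureOnCompacts μ] [μ.IsMulLeftInvariant]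
    (lam : Measure (skewC N Jw))
    (hwin : ∀ V K : Set (skewC N Jw), IsOpen V → (0 : skewC N Jw) ∈ V → IsCompact K → K ⊆ cayleySourceC N Jw → V ⊆ K →
      μ (cayleyChartC N Jw '' V) = ∫⁻ X in V, ENNReal.ofReal (cayleyWeightC N Jw X) ∂lam) :
    μ Set.univ = ∫⁻ X in cayleySourceC N Jw, ENNReal.ofReal (cayleyWeightC N Jw X) ∂lam := by
  rw [measure_univ_eq_measure_image_cayleySourceC μ, measure_image_cayleySourceC_eq_lintegral_of_window μ lam hwin]

/-- The any-window hypothesis in RESTRICTION form (`μ|_{ĉ(V)} = ĉ_*(w₀ · λ|_V)`, the shape of ★ (P0)) implies the total-mass form used above. [cite: Helgason2000, Ch. I §1 Thm. 1.14 (13) p. 96] -/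
theorem measure_image_eq_lintegral_of_restrict_eq (μ : Measure (unitaryGroupOfForm (starRingEnd ℂ) Jw)) (lam : Measure (skewC N Jw)) {V : Set (skewC N Jw)}
    (hVo : IsOpen V) (hVs : V ⊆ cayleySourceC N Jw) (h : μ.restrict (cayleyChartC N Jw '' V) = cayleyChartMeasureC N Jw lam V) :
    μ (cayleyChartC N Jw '' V) = ∫⁻ X in V, ENNReal.ofReal (cayleyWeightC N Jw X) ∂lam := by
  have hVW : cayleyChartC N Jw ⁻¹' (cayleyChartC N Jw '' V) ∩ V = V := Set.inter_eq_right.2 fun X hX => ⟨X, hX, rfl⟩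
  rw [← Measure.restrict_apply_self, h, cayleyChartMeasureC_apply lam _ (isOpen_image_cayleyChartC hVs hVo).measurableSet, hVW]

end Exhaustion

end UnitaryArchLocalTopForm

end Literature.NumberTheory.Weil1964

end
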